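import Mathlib
import HarnessLib
import Summits.Ventures.LatticeQCDFlow.Scaling.AutoregressiveGaugeHeatBathColdLaw
import Summits.Ventures.LatticeQCDFlow.Scaling.AutoregressiveGaugeHeatBathBurnIn
import Summits.Ventures.LatticeQCDFlow.Scaling.AutoregressiveGaugeColdEscapeDimension

/-!
# LatticeQCDFlow / Scaling — the cold-start law of the exact heat bath BY DIMENSION: every observable forgets the
# cold configuration within `(M/m)·log` steps on `(ℤ/L)²`, and keeps its cold bias for `θ₁^{−s}` steps,
# `(2(d−1)−1)s ≥ k_min(d, L)`, along an optimal structure in every dimension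

HONEST FRAMING: exact (Metropolis-corrected) sampling algorithms for lattice gauge theory;
figures of merit are autocorrelation/cost numbers at stated couplings and volumes; no
continuum-physics claim.

Venture `LatticeQCDFlow` (cell pub-lqcd), topic `Scaling`, FANOUT row 30 (lean-1, GEN-31) — OUR WORK, composing this
generation's exact cold-start laws (`AutoregressiveGaugeHeatBathColdLaw.heatBath_coldStart_observable`: `E_cold f(U_n) − π f
= (1 − A)^n (f(cold) − π f)`; `AutoregressiveGaugeHeatBathBurnIn`: burn-in `1/(εA)` up to `1 − ε`) with GEN-28's DIMENSION
DICHOTOMY of the exact cold escape rate `A = Z/(c^{#B} M^k)` along OPTIMAL ranked structures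
(`AutoregressiveGaugeColdEscapeDimension`: `A ≥ m/M` on `(ℤ/L)²` for every `L`; `A ≤ θ₁^s` with
`(2(d−1)−1)s ≥ k_min(d, L) = (d−1)(d−2)/2·L^d + (d−1)`, `θ₁ = c₂/(cM)`, in every dimension):

* **`two_dim_optimal_coldStart_observable_le`** — `d = 2`, optimal structure (`k = 1`), `w(1) = M`: for EVERY `L`, every
  `π`-integrable `f` and every `n`, `|E_cold f(U_n) − π f| ≤ (1 − m/M)^n·|f(cold) − π f|` — the plaquette, Wilson loops,
  the action forget the cold start at a volume-independent geometric rate;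
  **`two_dim_optimal_burnIn_sufficient`** — averaging `N ≥ (M/m)/ε` cold-started steps gives relative bias `≤ ε` for
  every observable, uniformly in `L`.
* **`optimal_coldStart_observable_ge`** — every `d ≥ 2`, optimal structure, `w(1) = M`: there is `s` with
  `(2(d−1)−1)s ≥ k_min(d, L)` such that for every `n` and every `π`-integrable `f`,
  `|E_cold f(U_n) − π f| ≥ (1 − n·θ₁^s)·|f(cold) − π f|` — for `n ≤ θ₁^{−s}/2` EVERY observable still carries at least
  half of its cold bias (`θ₁ < 1` for non-constant `w`: exponentially many steps in `L^d` when `d ≥ 3`);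
  **`optimal_burnIn_necessary`** — if averaging `N ≥ 1` cold-started steps gives relative bias `≤ ε ≤ 1` for one
  observable with `f(cold) ≠ π f`, then `(1 − ε)·θ₁^{−s} ≤ ε·N`; **`three_dim_optimal_burnIn_necessary`** — `d = 3`:
  the same with `3s ≥ L³ + 2`.

NOT CLAIMED: the value of `θ₁` for any specific weight (for Wilson-type weights `θ₁ < 1` is GEN-26's `M₂ < M`, a
property of `w`, not computed here); non-cold starts; anything about the all-closing conditioner by dimension.
No `def`, no `sorry`, nothing cited as a fact beyond the tree.
-/

noncomputable section

namespace Summit.Ventures.LatticeQCDFlow.Theory2.Autoregressive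

open MeasureTheory ProbabilityTheory Function Finset
open scoped ENNReal
open Literature.MathematicalPhysics.QuantumFieldTheory Literature.MathematicalPhysics.QuantumLattice
open Summit.Ventures.LatticeQCDFlow.Exactness Summit.Ventures.LatticeQCDFlow.Scoring

variable {d L : ℕ} [NeZero L] {G : Type*} [Group G] [TopologicalSpace G] [IsTopologicalGroup G]
  [CompactSpace G] [SecondCountableTopology G] [MeasurableSpace G] [BorelSpace G]

/-! ## Two dimensions: volume-independent forgetting -/

/-- **`d = 2`, OPTIMAL STRUCTURE: `|E_cold f(U_n) − π f| ≤ (1 − m/M)^n·|f(cold) − π f|` FOR EVERY `L`**, every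
`π`-integrable `f`, every `n`. [ours] -/
theorem two_dim_optimal_coldStart_observable_le [MeasurableSingletonClass G] (hL : 2 ≤ L) {w : G → ℝ} (hw : Continuous w) {m M : ℝ} (hm0 : 0 < m)
    (hm : ∀ g, m ≤ w g) (hM : ∀ g, w g ≤ M) (hw1 : w 1 = M)
    (B : Finset (Plaquette 2 L)) (t : Plaquette 2 L → Edge 2 L)
    (ht : ∀ p ∈ B, t p ∈ ({(p.1, p.2.1.1), (p.1.shift p.2.1.1, p.2.1.2),
        (p.1.shift p.2.1.2, p.2.1.1), (p.1, p.2.1.2)} : Finset (Edge 2 L)))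
    (rank : Plaquette 2 L → ℕ)
    (hrank : ∀ p ∈ B, ∀ p' ∈ B, p ≠ p' → t p ∈ ({(p'.1, p'.2.1.1), (p'.1.shift p'.2.1.1, p'.2.1.2),
        (p'.1.shift p'.2.1.2, p'.2.1.1), (p'.1, p'.2.1.2)} : Finset (Edge 2 L)) → rank p < rank p')
    (π q : Measure (GaugeConfig 2 L G)) [IsProbabilityMeasure π] [IsProbabilityMeasure q]
    (hπ : π = (Measure.pi fun _ : Edge 2 L => haarProbability G).withDensity fun U =>
      ENNReal.ofReal ((∏ p : Plaquette 2 L, w (plaquetteHolonomy U p.1 p.2.1.1 p.2.1.2)) /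
        ∫ V, ∏ p : Plaquette 2 L, w (plaquetteHolonomy V p.1 p.2.1.1 p.2.1.2)
          ∂(Measure.pi fun _ : Edge 2 L => haarProbability G)))
    (hq : q = (Measure.pi fun _ : Edge 2 L => haarProbability G).withDensity fun U =>
      ENNReal.ofReal ((∏ p ∈ B, w (plaquetteHolonomy U p.1 p.2.1.1 p.2.1.2)) /
        ∫ V, ∏ p ∈ B, w (plaquetteHolonomy V p.1 p.2.1.1 p.2.1.2)
          ∂(Measure.pi fun _ : Edge 2 L => haarProbability G)))
    (hopt : (Finset.univ \ B).card = 1) (n : ℕ) {f : GaugeConfig 2 L G → ℝ} (hf : Integrable f π) :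
    |∫ U, f U ∂((fun ν : Measure (GaugeConfig 2 L G) => ν.bind (indepMH q fun U =>
        ((∫ V, ∏ p : Plaquette 2 L, w (plaquetteHolonomy V p.1 p.2.1.1 p.2.1.2)
            ∂(Measure.pi fun _ : Edge 2 L => haarProbability G)) /
          ((∫ V, ∏ p ∈ B, w (plaquetteHolonomy V p.1 p.2.1.1 p.2.1.2)
            ∂(Measure.pi fun _ : Edge 2 L => haarProbability G)) *
            ∏ p ∈ Finset.univ \ B, w (plaquetteHolonomy U p.1 p.2.1.1 p.2.1.2)))⁻¹))^[n]
        (Measure.dirac (fun _ : Edge 2 L => (1 : G)))) - ∫ U, f U ∂π| ≤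
      (1 - m / M) ^ n * |f (fun _ : Edge 2 L => (1 : G)) - ∫ U, f U ∂π| := by
  have hw0 : ∀ g, 0 < w g := fun g => hm0.trans_le (hm g)
  have hMpos : 0 < M := (hw0 1).trans_le (hM 1)
  have hlaw := heatBath_coldStart_observable hL hw hm0 hm hM hw1 B t ht rank hrank π q hπ hq n hf
  have hge := two_dim_heatBath_coldRate_ge hL hw hm0 hm hM B t ht rank hrank hopt
  have hle1 := (heatBath_coldRate_bounds hL hw hm0 hm hM B t ht rank hrank).2
  rw [hlaw, abs_mul, abs_of_nonneg (pow_nonneg (sub_nonneg.2 hle1) n)]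
  exact mul_le_mul_of_nonneg_right (pow_le_pow_left₀ (sub_nonneg.2 hle1) (by linarith) n) (abs_nonneg _)

/-- **`d = 2`, OPTIMAL STRUCTURE: AVERAGING `N ≥ (M/m)/ε` COLD-STARTED STEPS GIVES RELATIVE BIAS `≤ ε` FOR EVERY
OBSERVABLE, UNIFORMLY IN `L`** (summed form: `|Σ_{n<N} (E_cold f(U_n) − π f)| ≤ ε·N·|f(cold) − π f|`). [ours] -/
theorem two_dim_optimal_burnIn_sufficient [MeasurableSingletonClass G] (hL : 2 ≤ L) {w : G → ℝ} (hw : Continuous w) {m M : ℝ} (hm0 : 0 < m)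
    (hm : ∀ g, m ≤ w g) (hM : ∀ g, w g ≤ M) (hw1 : w 1 = M)
    (B : Finset (Plaquette 2 L)) (t : Plaquette 2 L → Edge 2 L)
    (ht : ∀ p ∈ B, t p ∈ ({(p.1, p.2.1.1), (p.1.shift p.2.1.1, p.2.1.2),
        (p.1.shift p.2.1.2, p.2.1.1), (p.1, p.2.1.2)} : Finset (Edge 2 L)))
    (rank : Plaquette 2 L → ℕ)
    (hrank : ∀ p ∈ B, ∀ p' ∈ B, p ≠ p' → t p ∈ ({(p'.1, p'.2.1.1), (p'.1.shift p'.2.1.1, p'.2.1.2),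
        (p'.1.shift p'.2.1.2, p'.2.1.1), (p'.1, p'.2.1.2)} : Finset (Edge 2 L)) → rank p < rank p')
    (π q : Measure (GaugeConfig 2 L G)) [IsProbabilityMeasure π] [IsProbabilityMeasure q]
    (hπ : π = (Measure.pi fun _ : Edge 2 L => haarProbability G).withDensity fun U =>
      ENNReal.ofReal ((∏ p : Plaquette 2 L, w (plaquetteHolonomy U p.1 p.2.1.1 p.2.1.2)) /
        ∫ V, ∏ p : Plaquette 2 L, w (plaquetteHolonomy V p.1 p.2.1.1 p.2.1.2)
          ∂(Measure.pi fun _ : Edge 2 L => haarProbability G)))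
    (hq : q = (Measure.pi fun _ : Edge 2 L => haarProbability G).withDensity fun U =>
      ENNReal.ofReal ((∏ p ∈ B, w (plaquetteHolonomy U p.1 p.2.1.1 p.2.1.2)) /
        ∫ V, ∏ p ∈ B, w (plaquetteHolonomy V p.1 p.2.1.1 p.2.1.2)
          ∂(Measure.pi fun _ : Edge 2 L => haarProbability G)))
    (hopt : (Finset.univ \ B).card = 1) {N : ℕ} {ε : ℝ} (hN : M / m ≤ N * ε)
    {f : GaugeConfig 2 L G → ℝ} (hf : Integrable f π) :
    |∑ n ∈ Finset.range N, (∫ U, f U ∂((fun ν : Measure (GaugeConfig 2 L G) => ν.bind (indepMH q fun U =>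
        ((∫ V, ∏ p : Plaquette 2 L, w (plaquetteHolonomy V p.1 p.2.1.1 p.2.1.2)
            ∂(Measure.pi fun _ : Edge 2 L => haarProbability G)) /
          ((∫ V, ∏ p ∈ B, w (plaquetteHolonomy V p.1 p.2.1.1 p.2.1.2)
            ∂(Measure.pi fun _ : Edge 2 L => haarProbability G)) *
            ∏ p ∈ Finset.univ \ B, w (plaquetteHolonomy U p.1 p.2.1.1 p.2.1.2)))⁻¹))^[n]
        (Measure.dirac (fun _ : Edge 2 L => (1 : G)))) - ∫ U, f U ∂π)| ≤
      ε * N * |f (fun _ : Edge 2 L => (1 : G)) - ∫ U, f U ∂π| := by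
  have hw0 : ∀ g, 0 < w g := fun g => hm0.trans_le (hm g)
  have hMpos : 0 < M := (hw0 1).trans_le (hM 1)
  have hge := two_dim_heatBath_coldRate_ge hL hw hm0 hm hM B t ht rank hrank hopt
  have hmM : 0 < m / M := div_pos hm0 hMpos
  have hinv : ((∫ V, ∏ p : Plaquette 2 L, w (plaquetteHolonomy V p.1 p.2.1.1 p.2.1.2)
          ∂(Measure.pi fun _ : Edge 2 L => haarProbability G)) /
        ((∫ g, w g ∂(haarProbability G)) ^ B.card * M ^ (Finset.univ \ B).card))⁻¹ ≤ N * ε :=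
    ((inv_anti₀ hmM hge).trans_eq (inv_div m M)).trans hN
  exact heatBath_burnIn_sufficient hL hw hm0 hm hM hw1 B t ht rank hrank π q hπ hq hinv hf

/-! ## Every dimension: the cold bias survives `θ₁^{−s}` steps along an optimal structure -/

/-- **EVERY `d ≥ 2`, OPTIMAL STRUCTURE: there is `s` with `(2(d−1)−1)s ≥ k_min(d, L)` such that
`|E_cold f(U_n) − π f| ≥ (1 − n·θ₁^s)·|f(cold) − π f|` for every `n` and every `π`-integrable `f`**,
`θ₁ = (∫w²)/(M∫w)`: for `n ≤ θ₁^{−s}/2` every observable keeps at least half of its cold bias. [ours] -/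
theorem optimal_coldStart_observable_ge [MeasurableSingletonClass G] (hL : 2 ≤ L) {w : G → ℝ} (hw : Continuous w) {m M : ℝ} (hm0 : 0 < m)
    (hm : ∀ g, m ≤ w g) (hM : ∀ g, w g ≤ M) (hw1 : w 1 = M)
    (B : Finset (Plaquette d L)) (t : Plaquette d L → Edge d L)
    (ht : ∀ p ∈ B, t p ∈ ({(p.1, p.2.1.1), (p.1.shift p.2.1.1, p.2.1.2),
        (p.1.shift p.2.1.2, p.2.1.1), (p.1, p.2.1.2)} : Finset (Edge d L)))
    (rank : Plaquette d L → ℕ)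
    (hrank : ∀ p ∈ B, ∀ p' ∈ B, p ≠ p' → t p ∈ ({(p'.1, p'.2.1.1), (p'.1.shift p'.2.1.1, p'.2.1.2),
        (p'.1.shift p'.2.1.2, p'.2.1.1), (p'.1, p'.2.1.2)} : Finset (Edge d L)) → rank p < rank p')
    (π q : Measure (GaugeConfig d L G)) [IsProbabilityMeasure π] [IsProbabilityMeasure q]
    (hπ : π = (Measure.pi fun _ : Edge d L => haarProbability G).withDensity fun U =>
      ENNReal.ofReal ((∏ p : Plaquette d L, w (plaquetteHolonomy U p.1 p.2.1.1 p.2.1.2)) /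
        ∫ V, ∏ p : Plaquette d L, w (plaquetteHolonomy V p.1 p.2.1.1 p.2.1.2)
          ∂(Measure.pi fun _ : Edge d L => haarProbability G)))
    (hq : q = (Measure.pi fun _ : Edge d L => haarProbability G).withDensity fun U =>
      ENNReal.ofReal ((∏ p ∈ B, w (plaquetteHolonomy U p.1 p.2.1.1 p.2.1.2)) /
        ∫ V, ∏ p ∈ B, w (plaquetteHolonomy V p.1 p.2.1.1 p.2.1.2)
          ∂(Measure.pi fun _ : Edge d L => haarProbability G)))
    (hopt : (Finset.univ \ B).card = (d - 1) * (d - 2) / 2 * L ^ d + (d - 1)) :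
    ∃ s : ℕ, (d - 1) * (d - 2) / 2 * L ^ d + (d - 1) ≤ (2 * (d - 1) - 1) * s ∧
      ∀ (n : ℕ) (f : GaugeConfig d L G → ℝ), Integrable f π →
        (1 - n * ((∫ h, w h ^ 2 ∂(haarProbability G)) / ((∫ g, w g ∂(haarProbability G)) * M)) ^ s) *
            |f (fun _ : Edge d L => (1 : G)) - ∫ U, f U ∂π| ≤
          |∫ U, f U ∂((fun ν : Measure (GaugeConfig d L G) => ν.bind (indepMH q fun U =>
        ((∫ V, ∏ p : Plaquette d L, w (plaquetteHolonomy V p.1 p.2.1.1 p.2.1.2)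
            ∂(Measure.pi fun _ : Edge d L => haarProbability G)) /
          ((∫ V, ∏ p ∈ B, w (plaquetteHolonomy V p.1 p.2.1.1 p.2.1.2)
            ∂(Measure.pi fun _ : Edge d L => haarProbability G)) *
            ∏ p ∈ Finset.univ \ B, w (plaquetteHolonomy U p.1 p.2.1.1 p.2.1.2)))⁻¹))^[n]
            (Measure.dirac (fun _ : Edge d L => (1 : G)))) - ∫ U, f U ∂π| := by
  have hw0 : ∀ g, 0 < w g := fun g => hm0.trans_le (hm g)
  obtain ⟨s, hs, hAle⟩ := optimal_heatBath_coldRate_le_pow hL hw hm0 hm hM B t ht rank hrank hopt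
  have hbounds := heatBath_coldRate_bounds hL hw hm0 hm hM B t ht rank hrank
  refine ⟨s, hs, fun n f hf => ?_⟩
  have hlaw := heatBath_coldStart_observable hL hw hm0 hm hM hw1 B t ht rank hrank π q hπ hq n hf
  rw [hlaw, abs_mul, abs_of_nonneg (pow_nonneg (sub_nonneg.2 hbounds.2) n)]
  refine mul_le_mul_of_nonneg_right ?_ (abs_nonneg _)
  -- Bernoulli: `1 − n·A ≤ (1 − A)^n`, and `A ≤ θ₁^s`
  have hB : 1 + (n : ℝ) * (-((∫ V, ∏ p : Plaquette d L, w (plaquetteHolonomy V p.1 p.2.1.1 p.2.1.2)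
          ∂(Measure.pi fun _ : Edge d L => haarProbability G)) /
        ((∫ g, w g ∂(haarProbability G)) ^ B.card * M ^ (Finset.univ \ B).card))) ≤ (1 + (-((∫ V, ∏ p : Plaquette d L, w (plaquetteHolonomy V p.1 p.2.1.1 p.2.1.2)
          ∂(Measure.pi fun _ : Edge d L => haarProbability G)) /
        ((∫ g, w g ∂(haarProbability G)) ^ B.card * M ^ (Finset.univ \ B).card)))) ^ n :=
    one_add_mul_le_pow (by linarith [hbounds.2, hbounds.1, pow_nonneg (div_nonneg hm0.le ((hw0 1).le.trans (hM 1))) (Finset.univ \ B).card]) n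
  have h1 : (1 : ℝ) - n * ((∫ h, w h ^ 2 ∂(haarProbability G)) / ((∫ g, w g ∂(haarProbability G)) * M)) ^ s ≤ 1 + (n : ℝ) * (-((∫ V, ∏ p : Plaquette d L, w (plaquetteHolonomy V p.1 p.2.1.1 p.2.1.2)
          ∂(Measure.pi fun _ : Edge d L => haarProbability G)) /
        ((∫ g, w g ∂(haarProbability G)) ^ B.card * M ^ (Finset.univ \ B).card))) := by
    nlinarith [hAle, Nat.cast_nonneg (α := ℝ) n]
  calc (1 : ℝ) - n * ((∫ h, w h ^ 2 ∂(haarProbability G)) / ((∫ g, w g ∂(haarProbability G)) * M)) ^ s ≤ 1 + (n : ℝ) * (-((∫ V, ∏ p : Plaquette d L, w (plaquetteHolonomy V p.1 p.2.1.1 p.2.1.2)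
          ∂(Measure.pi fun _ : Edge d L => haarProbability G)) /
        ((∫ g, w g ∂(haarProbability G)) ^ B.card * M ^ (Finset.univ \ B).card))) := h1
    _ ≤ (1 + (-((∫ V, ∏ p : Plaquette d L, w (plaquetteHolonomy V p.1 p.2.1.1 p.2.1.2)
          ∂(Measure.pi fun _ : Edge d L => haarProbability G)) /
        ((∫ g, w g ∂(haarProbability G)) ^ B.card * M ^ (Finset.univ \ B).card)))) ^ n := hB
    _ = (1 - (∫ V, ∏ p : Plaquette d L, w (plaquetteHolonomy V p.1 p.2.1.1 p.2.1.2)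
          ∂(Measure.pi fun _ : Edge d L => haarProbability G)) /
        ((∫ g, w g ∂(haarProbability G)) ^ B.card * M ^ (Finset.univ \ B).card)) ^ n := by rw [← sub_eq_add_neg]

/-- **EVERY `d ≥ 2`, OPTIMAL STRUCTURE: THE NECESSARY BURN-IN IS `(1 − ε)·θ₁^{−s}/ε`, `(2(d−1)−1)s ≥ k_min(d, L)`**:
if averaging `N ≥ 1` cold-started steps gives relative bias `≤ ε ≤ 1` for one `π`-integrable observable with
`f(cold) ≠ π f`, then `(1 − ε)·(θ₁^s)⁻¹ ≤ ε·N`. [ours] -/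
theorem optimal_burnIn_necessary [MeasurableSingletonClass G] (hL : 2 ≤ L) {w : G → ℝ} (hw : Continuous w) {m M : ℝ} (hm0 : 0 < m)
    (hm : ∀ g, m ≤ w g) (hM : ∀ g, w g ≤ M) (hw1 : w 1 = M)
    (B : Finset (Plaquette d L)) (t : Plaquette d L → Edge d L)
    (ht : ∀ p ∈ B, t p ∈ ({(p.1, p.2.1.1), (p.1.shift p.2.1.1, p.2.1.2),
        (p.1.shift p.2.1.2, p.2.1.1), (p.1, p.2.1.2)} : Finset (Edge d L)))
    (rank : Plaquette d L → ℕ)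
    (hrank : ∀ p ∈ B, ∀ p' ∈ B, p ≠ p' → t p ∈ ({(p'.1, p'.2.1.1), (p'.1.shift p'.2.1.1, p'.2.1.2),
        (p'.1.shift p'.2.1.2, p'.2.1.1), (p'.1, p'.2.1.2)} : Finset (Edge d L)) → rank p < rank p')
    (π q : Measure (GaugeConfig d L G)) [IsProbabilityMeasure π] [IsProbabilityMeasure q]
    (hπ : π = (Measure.pi fun _ : Edge d L => haarProbability G).withDensity fun U =>
      ENNReal.ofReal ((∏ p : Plaquette d L, w (plaquetteHolonomy U p.1 p.2.1.1 p.2.1.2)) /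
        ∫ V, ∏ p : Plaquette d L, w (plaquetteHolonomy V p.1 p.2.1.1 p.2.1.2)
          ∂(Measure.pi fun _ : Edge d L => haarProbability G)))
    (hq : q = (Measure.pi fun _ : Edge d L => haarProbability G).withDensity fun U =>
      ENNReal.ofReal ((∏ p ∈ B, w (plaquetteHolonomy U p.1 p.2.1.1 p.2.1.2)) /
        ∫ V, ∏ p ∈ B, w (plaquetteHolonomy V p.1 p.2.1.1 p.2.1.2)
          ∂(Measure.pi fun _ : Edge d L => haarProbability G)))
    (hopt : (Finset.univ \ B).card = (d - 1) * (d - 2) / 2 * L ^ d + (d - 1)) :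
    ∃ s : ℕ, (d - 1) * (d - 2) / 2 * L ^ d + (d - 1) ≤ (2 * (d - 1) - 1) * s ∧
      ∀ (N : ℕ), 0 < N → ∀ (ε : ℝ), ε ≤ 1 → ∀ (f : GaugeConfig d L G → ℝ), Integrable f π →
        f (fun _ : Edge d L => (1 : G)) ≠ ∫ U, f U ∂π →
        |∑ n ∈ Finset.range N, (∫ U, f U ∂((fun ν : Measure (GaugeConfig d L G) => ν.bind (indepMH q fun U =>
        ((∫ V, ∏ p : Plaquette d L, w (plaquetteHolonomy V p.1 p.2.1.1 p.2.1.2)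
            ∂(Measure.pi fun _ : Edge d L => haarProbability G)) /
          ((∫ V, ∏ p ∈ B, w (plaquetteHolonomy V p.1 p.2.1.1 p.2.1.2)
            ∂(Measure.pi fun _ : Edge d L => haarProbability G)) *
            ∏ p ∈ Finset.univ \ B, w (plaquetteHolonomy U p.1 p.2.1.1 p.2.1.2)))⁻¹))^[n]
        (Measure.dirac (fun _ : Edge d L => (1 : G)))) - ∫ U, f U ∂π)| ≤
          ε * N * |f (fun _ : Edge d L => (1 : G)) - ∫ U, f U ∂π| →
        (1 - ε) * (((∫ h, w h ^ 2 ∂(haarProbability G)) / ((∫ g, w g ∂(haarProbability G)) * M)) ^ s)⁻¹ ≤ ε * N := by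
  have hw0 : ∀ g, 0 < w g := fun g => hm0.trans_le (hm g)
  have hMpos : 0 < M := (hw0 1).trans_le (hM 1)
  obtain ⟨s, hs, hAle⟩ := optimal_heatBath_coldRate_le_pow hL hw hm0 hm hM B t ht rank hrank hopt
  have hbounds := heatBath_coldRate_bounds hL hw hm0 hm hM B t ht rank hrank
  have hApos : 0 < (∫ V, ∏ p : Plaquette d L, w (plaquetteHolonomy V p.1 p.2.1.1 p.2.1.2)
          ∂(Measure.pi fun _ : Edge d L => haarProbability G)) /
        ((∫ g, w g ∂(haarProbability G)) ^ B.card * M ^ (Finset.univ \ B).card) :=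
    lt_of_lt_of_le (pow_pos (div_pos hm0 hMpos) _) hbounds.1
  refine ⟨s, hs, fun N hN ε hε f hf hfx hbias => ?_⟩
  have hnec := heatBath_burnIn_necessary hL hw hm0 hm hM hw1 B t ht rank hrank π q hπ hq hN hf hfx hbias
  have hinv : (((∫ h, w h ^ 2 ∂(haarProbability G)) / ((∫ g, w g ∂(haarProbability G)) * M)) ^ s)⁻¹ ≤ ((∫ V, ∏ p : Plaquette d L, w (plaquetteHolonomy V p.1 p.2.1.1 p.2.1.2)
          ∂(Measure.pi fun _ : Edge d L => haarProbability G)) /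
        ((∫ g, w g ∂(haarProbability G)) ^ B.card * M ^ (Finset.univ \ B).card))⁻¹ := inv_anti₀ hApos hAle
  calc (1 - ε) * (((∫ h, w h ^ 2 ∂(haarProbability G)) / ((∫ g, w g ∂(haarProbability G)) * M)) ^ s)⁻¹ ≤ (1 - ε) * ((∫ V, ∏ p : Plaquette d L, w (plaquetteHolonomy V p.1 p.2.1.1 p.2.1.2)
          ∂(Measure.pi fun _ : Edge d L => haarProbability G)) /
        ((∫ g, w g ∂(haarProbability G)) ^ B.card * M ^ (Finset.univ \ B).card))⁻¹ :=
        mul_le_mul_of_nonneg_left hinv (sub_nonneg.2 hε)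
    _ = ((∫ V, ∏ p : Plaquette d L, w (plaquetteHolonomy V p.1 p.2.1.1 p.2.1.2)
          ∂(Measure.pi fun _ : Edge d L => haarProbability G)) /
        ((∫ g, w g ∂(haarProbability G)) ^ B.card * M ^ (Finset.univ \ B).card))⁻¹ * (1 - ε) := mul_comm _ _
    _ ≤ ε * N := hnec

/-- **`d = 3`: THE NECESSARY COLD-START BURN-IN ALONG AN OPTIMAL STRUCTURE OF `(ℤ/L)³` IS `(1 − ε)·θ₁^{−s}/ε` WITH
`3s ≥ L³ + 2`** — exponential in the volume whenever `θ₁ < 1`. [ours] -/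
theorem three_dim_optimal_burnIn_necessary [MeasurableSingletonClass G] (hL : 2 ≤ L) {w : G → ℝ} (hw : Continuous w) {m M : ℝ} (hm0 : 0 < m)
    (hm : ∀ g, m ≤ w g) (hM : ∀ g, w g ≤ M) (hw1 : w 1 = M)
    (B : Finset (Plaquette 3 L)) (t : Plaquette 3 L → Edge 3 L)
    (ht : ∀ p ∈ B, t p ∈ ({(p.1, p.2.1.1), (p.1.shift p.2.1.1, p.2.1.2),
        (p.1.shift p.2.1.2, p.2.1.1), (p.1, p.2.1.2)} : Finset (Edge 3 L)))
    (rank : Plaquette 3 L → ℕ)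
    (hrank : ∀ p ∈ B, ∀ p' ∈ B, p ≠ p' → t p ∈ ({(p'.1, p'.2.1.1), (p'.1.shift p'.2.1.1, p'.2.1.2),
        (p'.1.shift p'.2.1.2, p'.2.1.1), (p'.1, p'.2.1.2)} : Finset (Edge 3 L)) → rank p < rank p')
    (π q : Measure (GaugeConfig 3 L G)) [IsProbabilityMeasure π] [IsProbabilityMeasure q]
    (hπ : π = (Measure.pi fun _ : Edge 3 L => haarProbability G).withDensity fun U =>
      ENNReal.ofReal ((∏ p : Plaquette 3 L, w (plaquetteHolonomy U p.1 p.2.1.1 p.2.1.2)) /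
        ∫ V, ∏ p : Plaquette 3 L, w (plaquetteHolonomy V p.1 p.2.1.1 p.2.1.2)
          ∂(Measure.pi fun _ : Edge 3 L => haarProbability G)))
    (hq : q = (Measure.pi fun _ : Edge 3 L => haarProbability G).withDensity fun U =>
      ENNReal.ofReal ((∏ p ∈ B, w (plaquetteHolonomy U p.1 p.2.1.1 p.2.1.2)) /
        ∫ V, ∏ p ∈ B, w (plaquetteHolonomy V p.1 p.2.1.1 p.2.1.2)
          ∂(Measure.pi fun _ : Edge 3 L => haarProbability G)))
    (hopt : (Finset.univ \ B).card = L ^ 3 + 2) :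
    ∃ s : ℕ, L ^ 3 + 2 ≤ 3 * s ∧
      ∀ (N : ℕ), 0 < N → ∀ (ε : ℝ), ε ≤ 1 → ∀ (f : GaugeConfig 3 L G → ℝ), Integrable f π →
        f (fun _ : Edge 3 L => (1 : G)) ≠ ∫ U, f U ∂π →
        |∑ n ∈ Finset.range N, (∫ U, f U ∂((fun ν : Measure (GaugeConfig 3 L G) => ν.bind (indepMH q fun U =>
        ((∫ V, ∏ p : Plaquette 3 L, w (plaquetteHolonomy V p.1 p.2.1.1 p.2.1.2)
            ∂(Measure.pi fun _ : Edge 3 L => haarProbability G)) /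
          ((∫ V, ∏ p ∈ B, w (plaquetteHolonomy V p.1 p.2.1.1 p.2.1.2)
            ∂(Measure.pi fun _ : Edge 3 L => haarProbability G)) *
            ∏ p ∈ Finset.univ \ B, w (plaquetteHolonomy U p.1 p.2.1.1 p.2.1.2)))⁻¹))^[n]
        (Measure.dirac (fun _ : Edge 3 L => (1 : G)))) - ∫ U, f U ∂π)| ≤
          ε * N * |f (fun _ : Edge 3 L => (1 : G)) - ∫ U, f U ∂π| →
        (1 - ε) * (((∫ h, w h ^ 2 ∂(haarProbability G)) / ((∫ g, w g ∂(haarProbability G)) * M)) ^ s)⁻¹ ≤ ε * N := by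
  have hopt' : (Finset.univ \ B).card = (3 - 1) * (3 - 2) / 2 * L ^ 3 + (3 - 1) := by
    rw [hopt]; norm_num
  obtain ⟨s, hs, h⟩ := optimal_burnIn_necessary hL hw hm0 hm hM hw1 B t ht rank hrank π q hπ hq hopt'
  refine ⟨s, ?_, h⟩
  norm_num at hs
  omega

end Summit.Ventures.LatticeQCDFlow.Theory2.Autoregressive

end
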